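import Summits.QuantumFields.BalabanUV.T4Continuum.Support.NE3BoxRestrictionPeriodic
import Summits.QuantumFields.BalabanUV.T4Continuum.Support.NE3QuadRemainderFibre
import HarnessLib

/-!
# T⁴ programme, node NE3, route Π item Π-C (file Π-C-3e «LOCAL END ON THE BOX OF RECORD») — `‖C_W^{(k)}(X)(z,κ)‖ ≤ C₂·(L^k·m)²` and, at a fibre point,
# `‖D_W^{(K)} X (z,κ)‖ ≤ C₂·(L^K·m)²`, for a sup `m` of `X` over the PRINTED dependency box `B^k(c₋) ∪ B^k(c₊)` = `[loK L k z, bondHiK L k z κ]`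

NE3 formalisation swarm `b2b-balaban-t4-ne3-formalise-*`, LEAF PROVER 02 (gen 7); the owner's ASK l.23181 (a)∕(b) + my INTENT l.23316: the LOCAL END of Π-C in the
currency of the owner's (Π-REG) shape `NE3LinearNormalPartPreSizes.LocalSupMajorant.dom` (box of record of [Balaban1985Averaging] p. 24, leaf-04-g7's
`NE3LinearisedAverageLocality` = Literature `B7Prop1Local.InBox∕AgreeOn∕loK∕bondHiK`), obtained from Π-C-3b's global END by leaf-04-g7's PERIODISED BOX RESTRICTION `NE3BoxRestrictionPeriodic.perRestrict` (the END carries `IsPeriodicDir X`, so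
the plain restriction `X·1_{B̃}` will not do: `X` is kept on every torus translate of the box; `norm_perRestrict_le`, `isPeriodicDir_perRestrict`,
`isSkewDir_perRestrict`, `relIter_sub_dirIter_eq_perRestrict` BY NAME) — no cut-off of our own (leaf-04's l.23350∕l.23410, no duplication).

CONTENT (all [folklore]; 0 sorry; 0 def): **`norm_relIter_sub_dirIter_le_box`** (box-local sup ⟹ the quadratic-remainder bound at `(z,κ)`), **`norm_dirIter_le_of_fibre_box`** (+ the fibre equation at the
top level ⟹ the linearised average itself is `≤ C₂·(L^K·m)²` at `(z,κ)` — the blockwise input `‖D_W X₀(z,κ)‖ ≤ C₂(M·m z κ)²` of file 3a∕3a′).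

HONEST FRAMING.  Bookkeeping over landed ENDs; nothing about Bałaban's minimisers (the fibre equation and the majorant are HYPOTHESES); `DecomposedRep`'s sizes,
T-E_w♯, NE3 NOT proved; spine PROVED 0∕9; finite T⁴ rung (B)+1 — NOT infinite volume, NOT mass gap, NOT BetaPertH, NOT Clay.  ABSOLUTE RULE kept (context only:
[Balaban1985Averaging] p. 24, Prop. 4 (134)–(135) p. 38).  PLACEMENT: `Summits/QuantumFields/BalabanUV/`.  HONEST DEPENDENCY: continuum YM on T⁴ ⇐ BetaPertH ∧
nine spine estimates (0/9 proved); BetaPertH ⇐ (D1) ∧ (D4) ∧ CAP+tail; G-an2-4 gates asym, D1 and NE2/3/4.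
-/

set_option autoImplicit false

open scoped BigOperators Matrix.Norms.L2Operator
open Finset

namespace Summit.QuantumFields.BalabanUV.T4Continuum.NE3QuadRemainderLocalBox

open Literature.MathematicalPhysics.QuantumFieldTheory.Balaban1983to89
open B7Prop1Explicit B7Prop2Explicit
open B7Prop1Local (InBox AgreeOn loK bondHiK)
open T4AveragingDeficitWall (IsUnitaryCfg IsSkewDir SmallField vary)
open T4AveragingDeficitWallBoundary (IsPeriodicCfg)
open AveragingDeficitPeriodicCounting (IsPeriodicDir)
open AveragingDeficitMultiLevelPrep (cavgIter LevelSmall)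
open BlockAverageVaryDisc (rho0)
open NE3TangentCovariantTower (dirIter)
open NE3LinearisedAverageSup (curvSum)
open NE3QuadRemainderTower (relIter)
open NE3QuadRemainderSup (norm_relIter_sub_dirIter_le)
open NE3QuadRemainderFibre (relIter_eq_zero_of_fibre)
open NE3BoxRestrictionPeriodic (perRestrict norm_perRestrict_le isPeriodicDir_perRestrict isSkewDir_perRestrict relIter_sub_dirIter_eq_perRestrict)

noncomputable section

variable {d : ℕ} {n : Type*} [Fintype n] [DecidableEq n]

/-! ## The local END on the box and its fibre form -/

/-- **THE k-FOLD QUADRATIC REMAINDER, LOCAL SUP FORM ON THE BOX OF RECORD, k-FREE.**  Under the tower-class hypotheses of Π-C-3b (`2 ≤ L`, `W` unitary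
`(L^K·N)`-periodic, `0 ≤ x`, `LevelSmall d L K x`, `SmallField W x`, `curvSum d L K x ≤ (2∕3)L`), for a skew `(L^K·N)`-periodic `X`, a level `k ≤ K`, a coarse bond
`(z, κ)`, and a sup `s ≥ 0` of `X` over the bonds of the box `[loK L k z, bondHiK L k z κ]` (= `B^k(c₋) ∪ B^k(c₊)`) obeying `4(3+12d)²·L^K·s ≤ rho0²`:
`‖relIter L k W X z κ − dirIter L k W X z κ‖ ≤ (4(3+12d)³∕rho0²)·(L^k·s)²`. [cite: Balaban1985Averaging, Prop. 4 (134)–(135) p.38, p.24] -/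
theorem norm_relIter_sub_dirIter_le_box [Nonempty n] {L N K : ℕ} [NeZero N] (hL : 2 ≤ L) {W : Site d → Fin d → (Matrix n n ℂ)ˣ} {x : ℝ}
    (hWu : IsUnitaryCfg W) (hWP : IsPeriodicCfg W ((L ^ K * N : ℕ) : ℤ)) (hx : 0 ≤ x) (hsm : LevelSmall d L K x) (hWx : SmallField W x)
    (hA : curvSum d L K x ≤ 2 / 3 * L) {X : Site d → Fin d → Matrix n n ℂ} (hXs : IsSkewDir X) (hXP : IsPeriodicDir X ((L ^ K * N : ℕ) : ℤ))
    {k : ℕ} (hk : k ≤ K) (z : Site d) (κ : Fin d) {s : ℝ} (hs : 0 ≤ s)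
    (hdom : ∀ (y : Site d) (μ : Fin d), InBox (loK L k z) (bondHiK L k z κ) y → InBox (loK L k z) (bondHiK L k z κ) (y + e μ) → ‖X y μ‖ ≤ s)
    (hσ : 4 * (3 + 12 * (d : ℝ)) ^ 2 * (L : ℝ) ^ K * s ≤ rho0 d L ^ 2) :
    ‖relIter L k W X z κ - dirIter L k W X z κ‖ ≤ 4 * (3 + 12 * (d : ℝ)) ^ 3 / rho0 d L ^ 2 * ((L : ℝ) ^ k * s) ^ 2 := by
  have hL1 : 1 ≤ L := by omega
  have hX's : IsSkewDir (perRestrict ((L ^ K * N : ℕ) : ℤ) (loK L k z) (bondHiK L k z κ) X) := isSkewDir_perRestrict _ _ _ hXs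
  have hX'P : IsPeriodicDir (perRestrict ((L ^ K * N : ℕ) : ℤ) (loK L k z) (bondHiK L k z κ) X) ((L ^ K * N : ℕ) : ℤ) :=
    isPeriodicDir_perRestrict _ _ hXP
  have hX'sup : ∀ (y : Site d) (μ : Fin d), ‖perRestrict ((L ^ K * N : ℕ) : ℤ) (loK L k z) (bondHiK L k z κ) X y μ‖ ≤ s :=
    norm_perRestrict_le hXP hs hdom
  rw [relIter_sub_dirIter_eq_perRestrict hL1 k ((L ^ K * N : ℕ) : ℤ) W X z κ]
  exact norm_relIter_sub_dirIter_le hL hWu hWP hx hsm hWx hA hX's hX'P hs hX'sup hσ k hk z κ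

/-- **AT A FIBRE POINT, THE LINEARISED AVERAGE ON THE BOX OF RECORD**: with, in addition, a GLOBAL sup `s₀` of `X` (`4(3+12d)²·L^K·s₀ ≤ rho0²`) and the
fibre equation `cavgIter L K (vary W X 1) = cavgIter L K W`: `‖dirIter L K W X z κ‖ ≤ (4(3+12d)³∕rho0²)·(L^K·s)²` for a box-local sup `s` as above —
the blockwise input `‖D_W X₀ (z,κ)‖ ≤ C₂·(M·m z κ)²` of the owner's ν-letter, `dom`-typed. [folklore] -/
theorem norm_dirIter_le_of_fibre_box [Nonempty n] {L N K : ℕ} [NeZero N] (hL : 2 ≤ L) {W : Site d → Fin d → (Matrix n n ℂ)ˣ} {x : ℝ}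
    (hWu : IsUnitaryCfg W) (hWP : IsPeriodicCfg W ((L ^ K * N : ℕ) : ℤ)) (hx : 0 ≤ x) (hsm : LevelSmall d L K x) (hWx : SmallField W x)
    (hA : curvSum d L K x ≤ 2 / 3 * L) {X : Site d → Fin d → Matrix n n ℂ} (hXs : IsSkewDir X) (hXP : IsPeriodicDir X ((L ^ K * N : ℕ) : ℤ))
    {s₀ : ℝ} (hs₀ : 0 ≤ s₀) (hX : ∀ (y : Site d) (μ : Fin d), ‖X y μ‖ ≤ s₀)
    (hσ₀ : 4 * (3 + 12 * (d : ℝ)) ^ 2 * (L : ℝ) ^ K * s₀ ≤ rho0 d L ^ 2)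
    (hfib : cavgIter L K (vary W X 1) = cavgIter L K W) (z : Site d) (κ : Fin d) {s : ℝ} (hs : 0 ≤ s)
    (hdom : ∀ (y : Site d) (μ : Fin d), InBox (loK L K z) (bondHiK L K z κ) y → InBox (loK L K z) (bondHiK L K z κ) (y + e μ) → ‖X y μ‖ ≤ s)
    (hσ : 4 * (3 + 12 * (d : ℝ)) ^ 2 * (L : ℝ) ^ K * s ≤ rho0 d L ^ 2) :
    ‖dirIter L K W X z κ‖ ≤ 4 * (3 + 12 * (d : ℝ)) ^ 3 / rho0 d L ^ 2 * ((L : ℝ) ^ K * s) ^ 2 := by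
  have h := norm_relIter_sub_dirIter_le_box hL hWu hWP hx hsm hWx hA hXs hXP (k := K) le_rfl z κ hs hdom hσ
  rwa [relIter_eq_zero_of_fibre hL hWu hWP hx hsm hWx hA hXs hXP hs₀ hX hσ₀ hfib z κ, zero_sub, norm_neg] at h

end

end Summit.QuantumFields.BalabanUV.T4Continuum.NE3QuadRemainderLocalBox
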